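import Mathlib
import HarnessLib
import Literature.MathematicalPhysics.StatisticalMechanics.LennardJonesClusters
import Summits.AtomisticToContinuum.Crystallization.Theorems.GrainPercolationDialCrossCeiling
import Summits.AtomisticToContinuum.Crystallization.Theorems.ChargedEnergyGap.Negative.Unconditional

/-!
# LoopTunnelDial · crux T `PocketCase` (stmt-AtomisticToContinuum-27294) — the CURRENCY BRIDGE of concordance #6
(decomp-a2c lens-5 «finite/base range + asymptotic regime + bridge», generation 13; `--supports stmt-AtomisticToContinuum-27294`;
sorry-free; imports only `Mathlib`, `HarnessLib`, Literature and LANDED Theorems files — no Theses file of its own; `layer_card`/`core_card`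
come transitively through the landed `GrainPercolationDialCrossCeiling`, exactly as there.)

Critic row 123 (STATUS l.863 (C)) recorded that lens-1's far residual FAR′ (`FarGapFree 2 6` on 30303: GROUND-STATE WINDOWS, price `g` PER FAR
PARTICLE on the SITE-EXCESS SUM `Σ_{B}(𝓔ⁱ/2 − e⋆)`) and lens-5's far residual (`VolumeExcessFarPocket` on 27294: Q♯-SEQUENCES, conclusion
«some `R`-ball chunk has INTERNAL energy `≥ e·#S + κR³ − σ₁R²`», `e = lim E(N)/N`) are stated in DIFFERENT CURRENCIES, and named the three
things a kernel between them needs: (i) `e = e⋆`; (ii) a TWO-SIDED cross bound `|W(S) − 𝓔(y|S)| ≤ σR²` (the attractive half is the landed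
`CrossCeiling`, p781045); (iii) the window-world hypotheses.  This file discharges (i) and (ii) and proves the resulting CURRENCY BRIDGE;
(iii) is the typed mismatch that remains (module docstring §5).

§1 (GS-free identities) for every finite configuration `y`, particle set `S` and reference level `e₀`:
   `𝓔(y|S) − e₀·#S = X_{e₀}(S) − cross(S)/2`,   `W(S) − e₀·#S = X_{e₀}(S) + cross(S)/2`,
   where `X_{e₀}(S) := Σ_{i∈S}(𝓔ⁱ(y)/2 − e₀)` is lens-1's window currency, `W(S) = chunkEnergy y S` is lens-5's removal currency and
   `cross(S) := Σ_{i∈S} Σ_{k∉S} V_LJ(|y_i − y_k|) = W(S) − 𝓔(y|S)` (`cross_identity`, landed).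
§2 (ii, the missing half; GS-free) REPULSIVE CROSS CEILING `cross(B(p,R)) ≤ σ₃R²` on 7/10-separated configurations, `R ≥ 1` (the proof's
   explicit value is `σ₃ = 560·((10/7)¹²/12)·(27/7)³ ≈ 1.9·10⁵`, crude like the landed `σ₂`; the statements are existential): only sites
   of the outer unit layer (`layer_card`, ≤ 560R² of them) have partners outside the ball closer than `1`, at most `(27/7)³` each
   (`core_card`), each pair contributing `≤ (10/7)¹²/12` (`V_LJ ≤ r⁻¹²/12`); pairs at distance `≥ 1` contribute `≤ 0` (`lennardJones_nonpos`).
   With the landed attractive floor this gives `|cross(B(c,R))| ≤ max(σ₂,σ₃)·R²`.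
§3 (i) `e = e⋆`: any limit `e` of `E(N)/N` equals `e⋆ = ⨅_Q e(Q)` — the tree theorem `ChargedEnergyGapNegative.crysEnergyLimit` and
   uniqueness of limits (this is NOT conjunct (i) of `Crystallization`, which is the ATTAINMENT of the infimum).
§4 THE BRIDGE: a site-excess floor `X_{e⋆}(B(c,R)) ≥ t` implies the internal-energy floor `𝓔(y|B) ≥ e·#B + t − (σ₃/2)R²` (lens-1 ⟹
   lens-5 v2 currency, by §2) and the removal floor `W(B) ≥ e·#B + t − (σ₂/2)R²` (by the LANDED half alone); conversely an internal-energy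
   (resp. removal) floor implies a site-excess floor up to `(σ₂/2)R²` (resp. `(σ₃/2)R²`).  In particular `ExcessAt κ (σ₃/2) e R y` (lens-5's registered trigger conclusion,
   stated unfolded) follows from `κR³ ≤ X_{e⋆}(B(c,R))` for SOME particle `c`.
§5 WHAT REMAINS of concordance #6 (typed, not proved here): lens-1's `FarCertFree 2 6 ρ₁ g` prices a window `B(c,ρ₁)` (any point `c`) of a
   single GROUND STATE whose doubled ball `B(c,2ρ₁)` is ALL-(3/50)-LOOSE and 2-VOID-FREE, at COFINAL radii `ρ₁` (`FarGapFree`); lens-5's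
   `FarTrig φ m r D ρ R` supplies, eventually in `N` along a Q♯-sequence and for EVERY `R ≥ 1`, a tunnel-free particle `c` with far
   fraction `> φ` on `B(y_c,2R)` — no looseness of the whole doubled ball, no void-freeness, all radii.  Hence NO implication between the
   two typed residuals follows from §1–§4 alone; the writer's TREE keeps two far leaves.  The lens-5 g13 preview «stair-localised floors»
   (HOME/decomp-a2c-lens-5/g13/preview/) re-shapes lens-5's FAR stub (μ-stable antecedent, COFINAL radii, conclusion in `W`-currency on the
   trigger ball) so that §4 applies verbatim once (iii) is cut by lens-1's own predicates — a generation-14 move, critic first.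
-/

noncomputable section

namespace Summit.AtomisticToContinuum.Crystallization.Theorems.LoopTunnelDialCurrencyBridge

open scoped BigOperators Classical Topology
open Filter
open Literature.MathematicalPhysics.StatisticalMechanics
open Summit.AtomisticToContinuum.Crystallization.Theorems.GrainPercolationDialCrossCeiling
  (E3 restrictTo chunkEnergy ballChunk CrossCeiling cross_identity two_mul_interactionEnergy_restrictTo injective_of_sep
    stub_crossCeiling)
open Summit.AtomisticToContinuum.Crystallization.Theorems.ContactSaturationLadderCrossTermFloor (layer_card core_card)
open Summit.AtomisticToContinuum.Crystallization.Theorems.ChargedEnergyGapNegative (eStar crysEnergyLimit card_mul_eStar_le)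

variable {N : ℕ}

/-! ## §0 The two currencies (no new definitions: everything is stated over the landed `restrictTo` / `chunkEnergy` / `ballChunk`
and Literature's `siteEnergy`; «`X_{e₀}(S)`» abbreviates `∑ i ∈ S, (siteEnergy lennardJones y i / 2 - e₀)` and «`cross(S)`» abbreviates
`∑ i ∈ S, ∑ k ∈ Sᶜ, lennardJones (dist (y i) (y k)) = chunkEnergy y S - interactionEnergy lennardJones (restrictTo S y)` in the
docstrings only) -/

/-! ## §1 GS-free identities -/

/-- `𝓔ⁱ(y) = Σ_k V_LJ(|y_i − y_k|)`, diagonal included (`V_LJ(0) = 0`). [folklore] -/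
theorem siteEnergy_eq_sum_univ (y : Fin N → E3) (i : Fin N) :
    siteEnergy lennardJones y i = ∑ k, lennardJones (dist (y i) (y k)) := by
  unfold siteEnergy
  rw [← Finset.add_sum_erase Finset.univ _ (Finset.mem_univ i), dist_self, lennardJones_zero, zero_add]

/-- `Σ_{i∈S} 𝓔ⁱ = 2·𝓔(y|S) + cross(S)`. [folklore] -/
theorem sum_siteEnergy_eq (y : Fin N → E3) (S : Finset (Fin N)) :
    ∑ i ∈ S, siteEnergy lennardJones y i =
      2 * interactionEnergy lennardJones (restrictTo S y) + ∑ i ∈ S, ∑ k ∈ Sᶜ, lennardJones (dist (y i) (y k)) := by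
  rw [two_mul_interactionEnergy_restrictTo, ← Finset.sum_add_distrib]
  refine Finset.sum_congr rfl fun i _ => ?_
  rw [siteEnergy_eq_sum_univ, ← Finset.sum_add_sum_compl S]

/-- `Σ_{i∈S} 𝓔ⁱ = 𝓔(y|S) + W(S)`: the site energies of a chunk add up to its internal energy PLUS its removal energy
(`cross_identity`, landed). [folklore] -/
theorem sum_siteEnergy_eq_add_chunkEnergy (y : Fin N → E3) (S : Finset (Fin N)) :
    ∑ i ∈ S, siteEnergy lennardJones y i = interactionEnergy lennardJones (restrictTo S y) + chunkEnergy y S := by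
  have h1 := sum_siteEnergy_eq y S
  have h2 := cross_identity y S
  linarith

/-- **Internal-energy currency**: `𝓔(y|S) − e₀·#S = X_{e₀}(S) − cross(S)/2`. [folklore] -/
theorem interactionEnergy_restrictTo_sub (e₀ : ℝ) (y : Fin N → E3) (S : Finset (Fin N)) :
    interactionEnergy lennardJones (restrictTo S y) - e₀ * S.card =
      (∑ i ∈ S, (siteEnergy lennardJones y i / 2 - e₀)) -
        (chunkEnergy y S - interactionEnergy lennardJones (restrictTo S y)) / 2 := by
  rw [Finset.sum_sub_distrib, Finset.sum_const, nsmul_eq_mul, ← Finset.sum_div, sum_siteEnergy_eq_add_chunkEnergy]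
  ring

/-- **Removal currency**: `W(S) − e₀·#S = X_{e₀}(S) + cross(S)/2`. [folklore] -/
theorem chunkEnergy_sub (e₀ : ℝ) (y : Fin N → E3) (S : Finset (Fin N)) :
    chunkEnergy y S - e₀ * S.card =
      (∑ i ∈ S, (siteEnergy lennardJones y i / 2 - e₀)) +
        (chunkEnergy y S - interactionEnergy lennardJones (restrictTo S y)) / 2 := by
  have h1 := interactionEnergy_restrictTo_sub e₀ y S
  linarith

/-- GS-free floor of the internal-energy currency at level `e⋆`: `e⋆·#S ≤ 𝓔(y|S)` for injective `y` (`card_mul_eStar_le`). [folklore] -/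
theorem eStar_mul_card_le (y : Fin N → E3) (hy : Function.Injective y) (S : Finset (Fin N)) :
    eStar * S.card ≤ interactionEnergy lennardJones (restrictTo S y) := by
  have hinj : Function.Injective (restrictTo S y) := fun a b hab => (S.orderEmbOfFin rfl).injective (hy hab)
  have h := card_mul_eStar_le hinj
  simpa [mul_comm] using h

/-! ## §2 (ii) The repulsive cross ceiling (GS-free) -/

/-- `V_LJ(r) ≤ (10/7)¹²/12` for `r ≥ 7/10`. [folklore] -/
theorem lennardJones_le_of_ge {r : ℝ} (hr : (7 : ℝ) / 10 ≤ r) : lennardJones r ≤ (1 / 12) * ((10 : ℝ) / 7) ^ 12 := by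
  have hr0 : 0 < r := by linarith
  have h1 : r⁻¹ ≤ 10 / 7 := by
    rw [inv_eq_one_div]
    have := one_div_le_one_div_of_le (by norm_num : (0 : ℝ) < 7 / 10) hr
    simpa using this
  have h2 : (r⁻¹) ^ 12 ≤ ((10 : ℝ) / 7) ^ 12 := pow_le_pow_left₀ (inv_nonneg.2 hr0.le) h1 12
  have h3 : 0 ≤ (1 / 6) * (r⁻¹) ^ 6 := by positivity
  unfold lennardJones
  linarith

/-- **Repulsive cross ceiling about a point** (GS-free): for a `7/10`-separated `y : Fin N → ℝ³`, a point `p` and `R ≥ 1`,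
`Σ_{|y_i − p| ≤ R} Σ_{|y_k − p| > R} V_LJ(|y_i − y_k|) ≤ σ₃ R²`. [folklore] -/
theorem cross_ceiling_point : ∃ σ₃ : ℝ, 0 ≤ σ₃ ∧ ∀ (N : ℕ) (y : Fin N → E3),
    (∀ a b : Fin N, a ≠ b → (7 : ℝ) / 10 ≤ dist (y a) (y b)) → ∀ (p : E3) (R : ℝ), 1 ≤ R →
      ∑ i ∈ (Finset.univ.filter fun i : Fin N => dist (y i) p ≤ R),
        ∑ k ∈ (Finset.univ.filter fun i : Fin N => dist (y i) p ≤ R)ᶜ, lennardJones (dist (y i) (y k)) ≤ σ₃ * R ^ 2 := by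
  set B : ℝ := (1 / 12) * ((10 : ℝ) / 7) ^ 12 with hB
  set C₁ : ℝ := ((27 : ℝ) / 7) ^ 3 with hC₁
  have hB0 : 0 ≤ B := by rw [hB]; positivity
  have hC₁0 : 0 ≤ C₁ := by rw [hC₁]; positivity
  clear_value B C₁
  refine ⟨B * C₁ * 560, by positivity, ?_⟩
  intro N y hsep p R hR
  have hyinj : Function.Injective y := injective_of_sep hsep
  set W := Finset.univ.filter (fun i : Fin N => dist (y i) p ≤ R) with hW
  set T := Wᶜ with hT
  have hmW : ∀ i : Fin N, i ∈ W ↔ dist (y i) p ≤ R := fun i => by rw [hW]; simp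
  have hmT : ∀ k : Fin N, k ∈ T ↔ R < dist (y k) p := fun k => by
    rw [hT, Finset.mem_compl, hmW, not_le]
  -- per pair
  have hpair : ∀ i ∈ W, ∀ k ∈ T, lennardJones (dist (y i) (y k)) ≤ if dist (y i) (y k) < 1 then B else 0 := by
    intro i hi k hk
    have hki : k ≠ i := fun h => by
      rw [hmT] at hk; rw [hmW] at hi; rw [h] at hk; linarith
    by_cases hd : dist (y i) (y k) < 1
    · rw [if_pos hd, hB]
      exact lennardJones_le_of_ge (hsep i k (Ne.symm hki))
    · rw [if_neg hd]
      exact lennardJones_nonpos (not_lt.1 hd)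
  -- per site
  have hsite : ∀ i ∈ W, ∑ k ∈ T, lennardJones (dist (y i) (y k)) ≤ if R - 1 < dist (y i) p then B * C₁ else 0 := by
    intro i hi
    have h1 : ∑ k ∈ T, lennardJones (dist (y i) (y k)) ≤ ∑ k ∈ T, (if dist (y i) (y k) < 1 then B else 0) :=
      Finset.sum_le_sum (hpair i hi)
    have h2 : ∑ k ∈ T, (if dist (y i) (y k) < 1 then B else 0) = B * ((T.filter fun k => dist (y i) (y k) < 1).card : ℝ) := by
      rw [← Finset.sum_filter, Finset.sum_const, nsmul_eq_mul, mul_comm]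
    rw [h2] at h1
    by_cases hlay : R - 1 < dist (y i) p
    · rw [if_pos hlay]
      have hsub : (T.filter fun k => dist (y i) (y k) < 1) ⊆ Finset.univ.filter (fun k : Fin N => dist (y k) (y i) ≤ 1) := by
        intro k hk
        rw [Finset.mem_filter] at hk
        rw [Finset.mem_filter, dist_comm]
        exact ⟨Finset.mem_univ _, hk.2.le⟩
      have hcnt : ((T.filter fun k => dist (y i) (y k) < 1).card : ℝ) ≤ C₁ := by
        have hc := core_card y hyinj (δ := 7 / 10) (by norm_num) hsep (y i) (R := 1) zero_le_one
        have hC₁' : (2 * (1 : ℝ) / (7 / 10) + 1) ^ 3 = C₁ := by rw [hC₁]; norm_num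
        rw [hC₁'] at hc
        exact le_trans (by exact_mod_cast Finset.card_le_card hsub) hc
      exact h1.trans (mul_le_mul_of_nonneg_left hcnt hB0)
    · rw [if_neg hlay]
      have hempty : (T.filter fun k => dist (y i) (y k) < 1) = ∅ := by
        rw [Finset.filter_eq_empty_iff]
        intro k hk hd
        rw [hmT] at hk
        have ht := dist_triangle (y k) (y i) p
        rw [dist_comm (y k) (y i)] at ht
        push Not at hlay
        linarith
      rw [hempty, Finset.card_empty, Nat.cast_zero, mul_zero] at h1
      exact h1
  -- sum over the window: only the outer unit layer pays
  have hsum : ∑ i ∈ W, ∑ k ∈ T, lennardJones (dist (y i) (y k)) ≤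
      B * C₁ * ((Finset.univ.filter fun i : Fin N => R - 1 < dist (y i) p ∧ dist (y i) p ≤ R).card : ℝ) := by
    have h1 : ∑ i ∈ W, ∑ k ∈ T, lennardJones (dist (y i) (y k)) ≤ ∑ i ∈ W, (if R - 1 < dist (y i) p then B * C₁ else 0) :=
      Finset.sum_le_sum hsite
    have h2 : ∑ i ∈ W, (if R - 1 < dist (y i) p then B * C₁ else 0) = B * C₁ * ((W.filter fun i => R - 1 < dist (y i) p).card : ℝ) := by
      rw [← Finset.sum_filter, Finset.sum_const, nsmul_eq_mul, mul_comm]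
    have h3 : (W.filter fun i => R - 1 < dist (y i) p) = Finset.univ.filter (fun i : Fin N => R - 1 < dist (y i) p ∧ dist (y i) p ≤ R) := by
      ext i
      rw [Finset.mem_filter, hmW, Finset.mem_filter]
      simp only [Finset.mem_univ, true_and]
      exact ⟨fun h => ⟨h.2, h.1⟩, fun h => ⟨h.2, h.1⟩⟩
    rw [h2, h3] at h1
    exact h1
  -- the outer unit layer holds ≤ 560 R² sites
  have hlayer : ((Finset.univ.filter fun i : Fin N => R - 1 < dist (y i) p ∧ dist (y i) p ≤ R).card : ℝ) ≤ 560 * R ^ 2 := by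
    by_cases hR17 : (17 : ℝ) / 10 ≤ R
    · have h := layer_card y (δ := 7 / 10) (by norm_num) (by norm_num) hsep p (ρ := R) (m := 0)
        (by simp only [Nat.cast_zero, sub_zero]; linarith)
      simp only [Nat.cast_zero, sub_zero] at h
      have h2 : 48 * ((7 : ℝ) / 10)⁻¹ ^ 3 * (R + 1) ^ 2 ≤ 560 * R ^ 2 := by
        have hR1 : (R + 1) ^ 2 ≤ (2 * R) ^ 2 := pow_le_pow_left₀ (by linarith) (by linarith) 2
        have : ((7 : ℝ) / 10)⁻¹ ^ 3 = 1000 / 343 := by norm_num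
        rw [this]
        nlinarith
      exact h.trans h2
    · push Not at hR17
      have hsub : (Finset.univ.filter fun i : Fin N => R - 1 < dist (y i) p ∧ dist (y i) p ≤ R) ⊆
          Finset.univ.filter (fun i : Fin N => dist (y i) p ≤ R) := by
        intro i hi
        rw [Finset.mem_filter] at hi ⊢
        exact ⟨hi.1, hi.2.2⟩
      have hc := core_card y hyinj (δ := 7 / 10) (by norm_num) hsep p (R := R) (by linarith)
      have h1 : (2 * R / (7 / 10) + 1) ^ 3 ≤ ((41 : ℝ) / 7) ^ 3 := by
        apply pow_le_pow_left₀ (by positivity)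
        have : 2 * R / (7 / 10) = 20 / 7 * R := by ring
        rw [this]; linarith
      have h2 : ((41 : ℝ) / 7) ^ 3 ≤ 560 * R ^ 2 := by
        have : ((41 : ℝ) / 7) ^ 3 ≤ 560 := by norm_num
        nlinarith
      calc ((Finset.univ.filter fun i : Fin N => R - 1 < dist (y i) p ∧ dist (y i) p ≤ R).card : ℝ)
          ≤ ((Finset.univ.filter fun i : Fin N => dist (y i) p ≤ R).card : ℝ) := by exact_mod_cast Finset.card_le_card hsub
        _ ≤ (2 * R / (7 / 10) + 1) ^ 3 := hc
        _ ≤ 560 * R ^ 2 := h1.trans h2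
  have hBC : 0 ≤ B * C₁ := mul_nonneg hB0 hC₁0
  calc ∑ i ∈ W, ∑ k ∈ T, lennardJones (dist (y i) (y k))
      ≤ B * C₁ * ((Finset.univ.filter fun i : Fin N => R - 1 < dist (y i) p ∧ dist (y i) p ≤ R).card : ℝ) := hsum
    _ ≤ B * C₁ * (560 * R ^ 2) := mul_le_mul_of_nonneg_left hlayer hBC
    _ = B * C₁ * 560 * R ^ 2 := by ring

/-- **Repulsive cross ceiling for ball chunks** (the missing half of (ii)): `W(B(c,R)) − 𝓔(y|B(c,R)) ≤ σ₃R²` for `7/10`-separated `y`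
and `R ≥ 1`. [folklore] -/
theorem cross_ballChunk_le : ∃ σ₃ : ℝ, 0 ≤ σ₃ ∧ ∀ (N : ℕ) (y : Fin N → E3),
    (∀ a b : Fin N, a ≠ b → (7 : ℝ) / 10 ≤ dist (y a) (y b)) → ∀ (c : Fin N) (R : ℝ), 1 ≤ R →
      chunkEnergy y (ballChunk y c R) - interactionEnergy lennardJones (restrictTo (ballChunk y c R) y) ≤ σ₃ * R ^ 2 := by
  obtain ⟨σ₃, hσ₃, h⟩ := cross_ceiling_point
  refine ⟨σ₃, hσ₃, fun N y hsep c R hR => ?_⟩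
  rw [cross_identity]
  exact h N y hsep (y c) R hR

/-- **Two-sided cross bound** (ii of concordance #6): with the LANDED attractive floor (`CrossCeiling`, p781045),
`|W(B(c,R)) − 𝓔(y|B(c,R))| ≤ max(σ₂, σ₃)·R²`. [folklore] -/
theorem abs_cross_ballChunk_le : ∃ σ : ℝ, 0 ≤ σ ∧ ∀ (N : ℕ) (y : Fin N → E3),
    (∀ a b : Fin N, a ≠ b → (7 : ℝ) / 10 ≤ dist (y a) (y b)) → ∀ (c : Fin N) (R : ℝ), 1 ≤ R →
      |chunkEnergy y (ballChunk y c R) - interactionEnergy lennardJones (restrictTo (ballChunk y c R) y)| ≤ σ * R ^ 2 := by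
  obtain ⟨σ₂, hσ₂, hX⟩ := stub_crossCeiling
  obtain ⟨σ₃, hσ₃, hY⟩ := cross_ballChunk_le
  refine ⟨max σ₂ σ₃, le_max_of_le_left hσ₂, fun N y hsep c R hR => ?_⟩
  have hlo := (hX N y hsep c R hR).2
  have hhi := hY N y hsep c R hR
  have hR2 : 0 ≤ R ^ 2 := by positivity
  rw [abs_le]
  constructor
  · have : σ₂ * R ^ 2 ≤ max σ₂ σ₃ * R ^ 2 := mul_le_mul_of_nonneg_right (le_max_left _ _) hR2
    linarith
  · have : σ₃ * R ^ 2 ≤ max σ₂ σ₃ * R ^ 2 := mul_le_mul_of_nonneg_right (le_max_right _ _) hR2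
    linarith

/-! ## §3 (i) `e = e⋆` -/

/-- **(i) of concordance #6**: any limit `e` of `E(N)/N` (lens-5's level) IS lens-1's level `e⋆ = ⨅_Q e_LJ(Q)` (`= DialFreeSieve.eInf`,
`rfl`), by the tree theorem `crysEnergyLimit` and uniqueness of limits.  (Not conjunct (i) of `Crystallization`: that is ATTAINMENT.) [folklore] -/
theorem e_eq_eStar {e : ℝ} (he : Tendsto (fun N : ℕ => groundStateEnergy lennardJones 3 N / N) atTop (𝓝 e)) : e = eStar :=
  tendsto_nhds_unique he crysEnergyLimit

/-! ## §4 The currency bridge -/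

/-- **Bridge A (lens-1 currency ⟹ lens-5 v2 currency)**: a site-excess floor `t ≤ X_{e₀}(B(c,R))` gives the internal-energy floor
`e₀·#B + t − (σ₃/2)R² ≤ 𝓔(y|B(c,R))` (`7/10`-separated `y`, `R ≥ 1`; uses §2). [folklore] -/
theorem interactionEnergy_floor_of_siteExcess : ∃ σ₃ : ℝ, 0 ≤ σ₃ ∧ ∀ (N : ℕ) (y : Fin N → E3),
    (∀ a b : Fin N, a ≠ b → (7 : ℝ) / 10 ≤ dist (y a) (y b)) → ∀ (c : Fin N) (R : ℝ), 1 ≤ R → ∀ e₀ t : ℝ,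
      t ≤ ∑ i ∈ ballChunk y c R, (siteEnergy lennardJones y i / 2 - e₀) →
        e₀ * (ballChunk y c R).card + t - σ₃ / 2 * R ^ 2 ≤ interactionEnergy lennardJones (restrictTo (ballChunk y c R) y) := by
  obtain ⟨σ₃, hσ₃, hY⟩ := cross_ballChunk_le
  refine ⟨σ₃, hσ₃, fun N y hsep c R hR e₀ t ht => ?_⟩
  have h1 := interactionEnergy_restrictTo_sub e₀ y (ballChunk y c R)
  have h2 := hY N y hsep c R hR
  linarith

/-- **Bridge B (lens-1 currency ⟹ lens-5 removal currency)**, needing ONLY the landed half (`CrossCeiling`, p781045):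
`e₀·#B + t − (σ₂/2)R² ≤ W(B(c,R))`. [folklore] -/
theorem chunkEnergy_floor_of_siteExcess : ∃ σ₂ : ℝ, 0 ≤ σ₂ ∧ ∀ (N : ℕ) (y : Fin N → E3),
    (∀ a b : Fin N, a ≠ b → (7 : ℝ) / 10 ≤ dist (y a) (y b)) → ∀ (c : Fin N) (R : ℝ), 1 ≤ R → ∀ e₀ t : ℝ,
      t ≤ ∑ i ∈ ballChunk y c R, (siteEnergy lennardJones y i / 2 - e₀) →
        e₀ * (ballChunk y c R).card + t - σ₂ / 2 * R ^ 2 ≤ chunkEnergy y (ballChunk y c R) := by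
  obtain ⟨σ₂, hσ₂, hX⟩ := stub_crossCeiling
  refine ⟨σ₂, hσ₂, fun N y hsep c R hR e₀ t ht => ?_⟩
  have h1 := chunkEnergy_sub e₀ y (ballChunk y c R)
  have h2 := (hX N y hsep c R hR).2
  linarith

/-- **Bridge C (converse, lens-5 v2 currency ⟹ lens-1 currency)** up to the landed `(σ₂/2)R²`:
`e₀·#B + t ≤ 𝓔(y|B(c,R)) ⇒ t − (σ₂/2)R² ≤ X_{e₀}(B(c,R))`. [folklore] -/
theorem siteExcess_floor_of_interactionEnergy : ∃ σ₂ : ℝ, 0 ≤ σ₂ ∧ ∀ (N : ℕ) (y : Fin N → E3),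
    (∀ a b : Fin N, a ≠ b → (7 : ℝ) / 10 ≤ dist (y a) (y b)) → ∀ (c : Fin N) (R : ℝ), 1 ≤ R → ∀ e₀ t : ℝ,
      e₀ * (ballChunk y c R).card + t ≤ interactionEnergy lennardJones (restrictTo (ballChunk y c R) y) →
        t - σ₂ / 2 * R ^ 2 ≤ ∑ i ∈ ballChunk y c R, (siteEnergy lennardJones y i / 2 - e₀) := by
  obtain ⟨σ₂, hσ₂, hX⟩ := stub_crossCeiling
  refine ⟨σ₂, hσ₂, fun N y hsep c R hR e₀ t ht => ?_⟩
  have h1 := interactionEnergy_restrictTo_sub e₀ y (ballChunk y c R)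
  have h2 := (hX N y hsep c R hR).2
  linarith

/-- **Bridge D (converse, lens-5 removal currency ⟹ lens-1 currency)** up to `(σ₃/2)R²` (uses §2):
`e₀·#B + t ≤ W(B(c,R)) ⇒ t − (σ₃/2)R² ≤ X_{e₀}(B(c,R))`. [folklore] -/
theorem siteExcess_floor_of_chunkEnergy : ∃ σ₃ : ℝ, 0 ≤ σ₃ ∧ ∀ (N : ℕ) (y : Fin N → E3),
    (∀ a b : Fin N, a ≠ b → (7 : ℝ) / 10 ≤ dist (y a) (y b)) → ∀ (c : Fin N) (R : ℝ), 1 ≤ R → ∀ e₀ t : ℝ,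
      e₀ * (ballChunk y c R).card + t ≤ chunkEnergy y (ballChunk y c R) →
        t - σ₃ / 2 * R ^ 2 ≤ ∑ i ∈ ballChunk y c R, (siteEnergy lennardJones y i / 2 - e₀) := by
  obtain ⟨σ₃, hσ₃, hY⟩ := cross_ballChunk_le
  refine ⟨σ₃, hσ₃, fun N y hsep c R hR e₀ t ht => ?_⟩
  have h1 := chunkEnergy_sub e₀ y (ballChunk y c R)
  have h2 := hY N y hsep c R hR
  linarith

/-- From a PER-FAR-PARTICLE price (lens-1's shape `g·#far ≤ X`) and a far FRACTION `> φ` (lens-5's trigger shape) to a price per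
particle of the window — pure arithmetic. [folklore] -/
theorem volume_of_farPrice {g φ X nfar n : ℝ} (hg : 0 ≤ g) (hprice : g * nfar ≤ X) (hfrac : φ * n < nfar) : g * φ * n ≤ X := by
  have : g * (φ * n) ≤ g * nfar := mul_le_mul_of_nonneg_left hfrac.le hg
  linarith

/-- **The `ExcessAt` corollary** (lens-5's registered trigger conclusion from a lens-1-currency floor): there is `σ₁ ≥ 0` such that
whenever `E(N)/N → e` and SOME particle `c` of a `7/10`-separated `y` has `κR³ ≤ X_{e⋆}(B(c,R))` (`R ≥ 1`), then
`∃ c, e·#B(c,R) + κR³ − σ₁R² ≤ 𝓔(y|B(c,R))` — which IS the skeleton's `ExcessAt κ σ₁ e R y` (27294, LINE v2), by `Iff.rfl`. [folklore] -/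
theorem excessAt_of_siteExcess : ∃ σ₁ : ℝ, 0 ≤ σ₁ ∧ ∀ {e : ℝ},
    Tendsto (fun N : ℕ => groundStateEnergy lennardJones 3 N / N) atTop (𝓝 e) → ∀ (N : ℕ) (y : Fin N → E3),
      (∀ a b : Fin N, a ≠ b → (7 : ℝ) / 10 ≤ dist (y a) (y b)) → ∀ (κ R : ℝ), 1 ≤ R →
        (∃ c : Fin N, κ * R ^ 3 ≤ ∑ i ∈ ballChunk y c R, (siteEnergy lennardJones y i / 2 - eStar)) →
          ∃ c : Fin N, e * ((ballChunk y c R).card : ℝ) + κ * R ^ 3 - σ₁ * R ^ 2 ≤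
            interactionEnergy lennardJones (restrictTo (ballChunk y c R) y) := by
  obtain ⟨σ₃, hσ₃, hA⟩ := interactionEnergy_floor_of_siteExcess
  refine ⟨σ₃ / 2, by positivity, fun he N y hsep κ R hR h => ?_⟩
  obtain ⟨c, hc⟩ := h
  refine ⟨c, ?_⟩
  have h1 := hA N y hsep c R hR eStar (κ * R ^ 3) hc
  rw [e_eq_eStar he]
  linarith

/-- … and the removal-currency corollary with the LANDED constant: `e·#B + κR³ − (σ₂/2)R² ≤ W(B(c,R))`. [folklore] -/
theorem chunkExcess_of_siteExcess : ∃ σ₂ : ℝ, 0 ≤ σ₂ ∧ ∀ {e : ℝ},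
    Tendsto (fun N : ℕ => groundStateEnergy lennardJones 3 N / N) atTop (𝓝 e) → ∀ (N : ℕ) (y : Fin N → E3),
      (∀ a b : Fin N, a ≠ b → (7 : ℝ) / 10 ≤ dist (y a) (y b)) → ∀ (c : Fin N) (κ R : ℝ), 1 ≤ R →
        κ * R ^ 3 ≤ ∑ i ∈ ballChunk y c R, (siteEnergy lennardJones y i / 2 - eStar) →
          e * (ballChunk y c R).card + κ * R ^ 3 - σ₂ / 2 * R ^ 2 ≤ chunkEnergy y (ballChunk y c R) := by
  obtain ⟨σ₂, hσ₂, hB⟩ := chunkEnergy_floor_of_siteExcess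
  refine ⟨σ₂, hσ₂, fun he N y hsep c κ R hR h => ?_⟩
  have h1 := hB N y hsep c R hR eStar (κ * R ^ 3) h
  rw [e_eq_eStar he]
  exact h1

end Summit.AtomisticToContinuum.Crystallization.Theorems.LoopTunnelDialCurrencyBridge

end
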